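import Literature.Computability.Complexity.BISDownsets
import Literature.Computability.Complexity.TwoColouringScanCorrect
import Literature.Computability.Complexity.TwoColouringScanFP
import Literature.Computability.Complexity.OracleOneQuery
import HarnessLib

/-!
# `#BIS ≤_AP #DOWNSETS`: discharge of `DyerEtAl2003.BISAPReducibleDownsets` (DGGJ 2003, Theorem 5)

Dyer–Goldberg–Greenhill–Jerrum, *The relative complexity of approximate counting problems*,
Algorithmica 38 (2003) 471–500, Theorem 5 (p. 8 of the held preprint): "The problems `#BIS`,
`#P₄-COL`, …, `#DOWNSETS` and `#1P1NSAT` are all AP-interreducible"; direction `#BIS ≤_AP #DOWNSETS`.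
The printed proof reaches `#DOWNSETS` through Lemmas 6–8; the tree's direct form (module docstring of
`BISDownsets.lean`) is parsimonious: a bipartite graph with side `A` is the height-two order
`i ≻ j ⇔ i ∉ A, j ∈ A, ij ∈ E`, whose implication-closed sets are equinumerous with the independent
sets (`bisCount_encode_eq_downsetCount`, proved there). The converse direction, Lemma 9
(`DownsetsAPReducibleBIS_holds`), is the sibling `BISDownsetsProofs.lean`. What this file adds is the
TRANSDUCER of Theorem 5, in the transcript model of `FPRAS.lean` (`APReducible`,
`APReducible.intro_of_forall`):

* reading an ARBITRARY string `x` as `encodingGraph` does (`encodingGraph_decode_of_length_eq` /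
  `_ne`: size `n = decodeNat (fst x)`, adjacency bits `v = snd x`, well formed iff `|v| = n²`, the
  graph being `TwoColouring.graph n v`), so that `bisCount x` is `bisCount ⟨n, graph n v⟩` or `0`;
* the code identity `encode_implicationMatrix`: the `#DOWNSETS` instance written by the typed core
  `TwoColouring.core` (`TwoColouringScanFP.lean`: validity test, the polynomial 2-colouring scan of
  `TwoColouringScan.lean`, properness test, implication matrix) IS the code of
  `bipartiteImplicationMatrix (graph n v) (zeroSide …)`;
* the one-query oracle algorithm `OracleAlg.oneQuery D Q Out₀ Out₁` (`OracleOneQuery.lean`) with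
  `D` = the bit `good` of the core on the canonicalised instance (`bisPre`), `Q` = the counting query
  `⟨y, 1⁰, 1^{kη}, 1¹, ε⟩` for that instance `y` at the caller's accuracy, `Out₀ = ε` (the numeral
  `0`: the instance is malformed or not bipartite, `bisCount x = 0`), `Out₁` = the oracle's answer
  verbatim (parsimony: `downsetCount y = bisCount x`), its polynomial time (`isPolyTime_oneQuery`),
  and **`DyerEtAl2003.BISAPReducibleDownsets_holds`**.

## References

* M. Dyer, L. A. Goldberg, C. Greenhill, M. Jerrum, *The relative complexity of approximate counting
  problems*, Algorithmica 38 (2003) 471–500, Theorem 5 and §1 (AP-reductions) [DyerEtAl2003].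
* S. Arora, B. Barak, *Computational Complexity: A Modern Approach*, CUP 2009, §3.4, §1.3
  [AroraBarak2009].
-/

namespace Literature.Computability.Complexity

open _root_.Computability Polynomial Brick CodeFP

namespace TwoColouring

/-! ### Reading an arbitrary string as a graph code -/

/-- A bit string of length `n²` decodes (`encodingGraphFin n`) to the graph read off it. [folklore] -/
theorem decode_encodingGraphFin_of_length_eq {n : ℕ} {v : List Bool} (h : v.length = n * n) :
    (encodingGraphFin n).decode v = some (graph n v) := by
  have hbv : (encodingBitVec (n * n)).decode v = some (fun i => v.get (i.cast h.symm)) := by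
    simp [encodingBitVec, h]
  simp only [encodingGraphFin, hbv, Option.map_some, Option.some.injEq]
  ext i j
  rw [SimpleGraph.fromRel_adj, graph, SimpleGraph.fromRel_adj]
  have key : ∀ a b : Fin n,
      v.get ((finProdFinEquiv (a, b)).cast h.symm) = true ↔ bit v (b.val + n * a.val) = true := by
    intro a b
    have hlt : b.val + n * a.val < v.length := by
      rw [h]
      calc b.val + n * a.val < n + n * a.val := Nat.add_lt_add_right b.isLt _
        _ = n * (a.val + 1) := by ring
        _ ≤ n * n := Nat.mul_le_mul_left _ a.isLt
    rw [List.get_eq_getElem, bit, List.getD_eq_getElem _ _ hlt]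
    simp [finProdFinEquiv_apply_val]
  rw [key i j, key j i]

/-- A well-formed string decodes (`encodingGraph`) to the graph read off its size numeral and its
adjacency bits. [folklore] -/
theorem encodingGraph_decode_of_length_eq {x : List Bool}
    (h : (sndF x).length = decodeNat (fstF x) * decodeNat (fstF x)) :
    encodingGraph.decode x = some ⟨decodeNat (fstF x), graph (decodeNat (fstF x)) (sndF x)⟩ := by
  change sigmaBoolDecode encodingGraphFin (decodeNat (fstF x)) (sndF x) = _
  rw [sigmaBoolDecode, decode_encodingGraphFin_of_length_eq h, Option.map_some]

/-- A malformed string does not decode. [folklore] -/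
theorem encodingGraph_decode_of_length_ne {x : List Bool}
    (h : (sndF x).length ≠ decodeNat (fstF x) * decodeNat (fstF x)) : encodingGraph.decode x = none := by
  change sigmaBoolDecode encodingGraphFin (decodeNat (fstF x)) (sndF x) = _
  simp [sigmaBoolDecode, encodingGraphFin, encodingBitVec, h]

/-- `#BIS` of a malformed string is `0`. [folklore] -/
theorem bisCount_of_length_ne {x : List Bool}
    (h : (sndF x).length ≠ decodeNat (fstF x) * decodeNat (fstF x)) : bisCount x = 0 := by
  simp only [bisCount, encodingGraph_decode_of_length_ne h, Option.elim]

/-- `#BIS` of a well-formed string is `#BIS` of the canonical code of its graph. [folklore] -/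
theorem bisCount_of_length_eq {x : List Bool}
    (h : (sndF x).length = decodeNat (fstF x) * decodeNat (fstF x)) :
    bisCount x = bisCount (encodingGraph.encode ⟨decodeNat (fstF x), graph (decodeNat (fstF x)) (sndF x)⟩) := by
  simp only [bisCount, encodingGraph_decode_of_length_eq h, encodingGraph.decode_encode]

/-! ### The `#DOWNSETS` instance written by the core is the code of the implication matrix -/

/-- The row-major table of a function on `[0, n)²` as nested `ofFn`s. [folklore] -/
theorem ofFn_ofFn_eq_map_map {α : Type} (n : ℕ) (g : ℕ → ℕ → α) :
    (List.ofFn fun i : Fin n => List.ofFn fun j : Fin n => g i.val j.val) =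
      (List.range n).map fun i => (List.range n).map fun j => g i j := by
  apply List.ext_getElem (by simp)
  intro i h₁ h₂
  simp only [List.getElem_ofFn, List.getElem_map, List.getElem_range]
  apply List.ext_getElem (by simp)
  intro j h₃ h₄
  simp

/-- The entries of the scan are those of `bipartiteImplicationMatrix` for the side `{colour 0}`.
[folklore] -/
theorem entry_eq_bipartiteImplicationMatrix (n : ℕ) (v : List Bool) (c : List ℕ) (i j : Fin n) :
    entry n v c i.val j.val = bipartiteImplicationMatrix (graph n v) (zeroSide n c) i j := by
  unfold entry bipartiteImplicationMatrix
  have hA : ∀ k : Fin n, k ∈ zeroSide n c ↔ col c k.val = 0 := fun k => by simp [zeroSide]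
  simp only [hA, graph_adj]
  by_cases h1 : col c i.val = 0 <;> by_cases h2 : col c j.val = 0 <;>
    by_cases h3 : adj n v i.val j.val = true <;> simp [h1, h2, h3]

/-- Row-major linear indices: `⟨i n + j⟩.divNat = i`, `⟨i n + j⟩.modNat = j`. [folklore] -/
theorem divNat_modNat_of_val_eq {n : ℕ} (k : Fin (n * n)) (i j : Fin n) (hk : k.val = i.val * n + j.val) :
    k.divNat = i ∧ k.modNat = j := by
  have hn : 0 < n := Nat.pos_of_ne_zero fun h => by subst h; exact i.elim0
  constructor
  · apply Fin.ext
    rw [Fin.coe_divNat, hk, Nat.mul_comm, Nat.mul_add_div hn, Nat.div_eq_of_lt j.isLt, Nat.add_zero]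
  · apply Fin.ext
    rw [Fin.coe_modNat, hk, Nat.mul_comm, Nat.mul_add_mod, Nat.mod_eq_of_lt j.isLt]

/-- **The instance written by the core is the code of the implication matrix**:
`encodingNatMatrix.encode ⟨n, bipartiteImplicationMatrix (graph n v) (zeroSide n c)⟩ =
⟨bin n, listE bin (entries n v c)⟩`. [folklore] -/
theorem encode_implicationMatrix (n : ℕ) (v : List Bool) (c : List ℕ) :
    encodingNatMatrix.encode ⟨n, bipartiteImplicationMatrix (graph n v) (zeroSide n c)⟩ =
      pairE natE (listE natE) (n, entries n v c) := by
  set M := bipartiteImplicationMatrix (graph n v) (zeroSide n c) with hM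
  set e : (Fin n → Fin n → ℕ) ≃ (Fin (n * n) → ℕ) :=
    (Equiv.curry (Fin n) (Fin n) ℕ).symm.trans (finProdFinEquiv.arrowCongr (Equiv.refl ℕ)) with he
  change boolPair (encodeNat n) (encodingNatBool.listBool.encode (List.ofFn (e M))) =
    boolPair (natE n) (listE natE (entries n v c))
  rw [listE_eq]
  change boolPair (natE n) (listE natE (List.ofFn (e M))) = _
  congr 2
  have heM : (e M : Fin (n * n) → ℕ) = fun k => M k.divNat k.modNat := by
    funext k
    simp [he, Equiv.arrowCongr_apply, Function.uncurry]
  rw [heM, List.ofFn_mul, entries, ← ofFn_ofFn_eq_map_map]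
  refine congrArg List.flatten (congrArg List.ofFn (funext fun i => congrArg List.ofFn (funext fun j => ?_)))
  obtain ⟨h1, h2⟩ := divNat_modNat_of_val_eq (⟨i.val * n + j.val, _⟩ : Fin (n * n)) i j rfl
  rw [h1, h2, entry_eq_bipartiteImplicationMatrix]

/-! ### Consequences of the core's verdict -/

/-- On a well-formed code the capped size is the size. [folklore] -/
theorem min_eq_of_length_eq {n : ℕ} {v : List Bool} (h : v.length = n * n) : min n v.length = n :=
  min_eq_left (h ▸ Nat.le_mul_self n)

/-- **Good instances**: `#BIS` of the string is `#DOWNSETS` of the instance written by the core.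
[cite: DyerEtAl2003, Theorem 5] -/
theorem bisCount_eq_downsetCount_of_good {x : List Bool}
    (hgood : (core (decodeNat (fstF x)) (sndF x)).1 = true) :
    bisCount x = downsetCount (pairE natE (listE natE) (core (decodeNat (fstF x)) (sndF x)).2) := by
  set n := decodeNat (fstF x)
  set v := sndF x
  simp only [core, Bool.and_eq_true, decide_eq_true_eq] at hgood
  obtain ⟨hlen, hproper⟩ := hgood
  rw [min_eq_of_length_eq hlen] at hproper
  simp only [core, min_eq_of_length_eq hlen]
  rw [bisCount_of_length_eq hlen, ← encode_implicationMatrix,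
    bisCount_encode_eq_downsetCount (graph n v) (zeroSide n (colouring n v)) (side_of_proper hproper)]

/-- **Bad instances**: `#BIS` of the string is `0` (malformed, or well formed and not bipartite —
else the scan would have found a proper colouring). [cite: DyerEtAl2003, Theorem 5] -/
theorem bisCount_eq_zero_of_not_good {x : List Bool}
    (hgood : (core (decodeNat (fstF x)) (sndF x)).1 = false) : bisCount x = 0 := by
  set n := decodeNat (fstF x)
  set v := sndF x
  by_cases hlen : v.length = n * n
  · simp only [core] at hgood
    rw [min_eq_of_length_eq hlen] at hgood
    simp only [hlen, decide_true, Bool.true_and] at hgood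
    have hnc : ¬ (graph n v).Colorable 2 := fun hc => by
      rw [proper_colouring_of_colorable hc] at hgood
      exact Bool.noConfusion hgood
    rw [bisCount_of_length_eq hlen, bisCount_encode_of_not_colorable hnc]
  · exact bisCount_of_length_ne hlen

end TwoColouring

/-! ### The stages of the transducer -/

namespace DyerEtAl2003

/-- Pre-processing of the machine input `w = ⟨⟨x, …⟩, u⟩`: the canonical size numeral and the
adjacency bits of the instance `x`, `⟨canonF (fst x), snd x⟩ = pairE natE strE (decodeNat (fst x), snd x)`.
[folklore] -/
noncomputable def bisPre : List Bool → List Bool :=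
  fanoutFn (canonF ∘ fstF ∘ fstF ∘ fstF) (sndF ∘ fstF ∘ fstF)

/-- `bisPre ∈ FP`. [folklore] -/
theorem bisPre_mem_FP : bisPre ∈ FP :=
  fanoutFn_mem_FP (comp_mem_FP canonF_mem_FP (comp_mem_FP fstF_mem_FP (comp_mem_FP fstF_mem_FP fstF_mem_FP)))
    (comp_mem_FP sndF_mem_FP (comp_mem_FP fstF_mem_FP fstF_mem_FP))

/-- Value of `bisPre` on every string: a genuine code of `ℕ × {0,1}*`. [folklore] -/
theorem bisPre_apply (w : List Bool) :
    bisPre w = pairE natE strE (decodeNat (fstF (fstF (fstF w))), sndF (fstF (fstF w))) := by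
  simp [bisPre, fanoutFn_apply, canonF_eq_encodeNat_decodeNat]

/-- Value of `bisPre` on a counting query. [folklore] -/
theorem bisPre_countQuery (x u : List Bool) (m kη kδ : ℕ) :
    bisPre (countQuery x m kη kδ u) = pairE natE strE (decodeNat (fstF x), sndF x) := by
  rw [bisPre_apply, countQuery, fstF_boolPair, fstF_boolPair]

/-- The accuracy field `1^{kη}` of the machine input. [folklore] -/
def bisAcc : List Bool → List Bool := fstF ∘ sndF ∘ sndF ∘ fstF

/-- `bisAcc ∈ FP`. [folklore] -/
theorem bisAcc_mem_FP : bisAcc ∈ FP :=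
  comp_mem_FP fstF_mem_FP (comp_mem_FP sndF_mem_FP (comp_mem_FP sndF_mem_FP fstF_mem_FP))

/-- Value of `bisAcc` on a counting query. [folklore] -/
theorem bisAcc_countQuery (x u : List Bool) (m kη kδ : ℕ) :
    bisAcc (countQuery x m kη kδ u) = unaryEncodeNat kη := by
  simp [bisAcc, countQuery]

/-- The query stage: the counting query `⟨y, 1⁰, 1^{kη}, 1¹, ε⟩` for the instance `y` written by the
core (run by the string function `f`). [folklore] -/
noncomputable def bisQuery (f : List Bool → List Bool) : List Bool → List Bool :=
  fanoutFn (fanoutFn (sndF ∘ f ∘ bisPre) (fanoutFn (fun _ => []) (fanoutFn bisAcc fun _ => [true]))) fun _ => []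

/-- `bisQuery f ∈ FP` for `f ∈ FP`. [folklore] -/
theorem bisQuery_mem_FP {f : List Bool → List Bool} (hf : f ∈ FP) : bisQuery f ∈ FP :=
  fanoutFn_mem_FP (fanoutFn_mem_FP (comp_mem_FP sndF_mem_FP (comp_mem_FP hf bisPre_mem_FP))
    (fanoutFn_mem_FP (const_mem_FP _) (fanoutFn_mem_FP bisAcc_mem_FP (const_mem_FP _)))) (const_mem_FP _)

/-- Value of `bisQuery` on a counting query: the counting query of the written instance at the
caller's accuracy, confidence slot `1`, no coins. [folklore] -/
theorem bisQuery_countQuery (f : List Bool → List Bool) (x u : List Bool) (kη kδ : ℕ) :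
    bisQuery f (countQuery x 0 kη kδ u) = countQuery (sndF (f (bisPre (countQuery x 0 kη kδ u)))) 0 kη 1 [] := by
  simp only [bisQuery, fanoutFn_apply, Function.comp_apply, bisAcc_countQuery]
  rfl

/-! ### The discharge -/

/-- **Dyer–Goldberg–Greenhill–Jerrum 2003, Theorem 5, direction `#BIS ≤_AP #DOWNSETS` — discharged.**
The one-query transducer: canonicalise the instance, run the 2-colouring scan and the properness
test (`TwoColouring.core`); if the code is malformed or the colouring is not proper (then the graph
is not bipartite and `bisCount = 0`) answer `0` without asking; otherwise ask the `#DOWNSETS` oracle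
ONCE for the implication matrix of the height-two order at the caller's accuracy and return its
answer verbatim (`bisCount x = downsetCount y`, parsimony). Coin-free, so an `APReducible` witness by
`APReducible.intro_of_forall`. [cite: DyerEtAl2003, Theorem 5] -/
theorem BISAPReducibleDownsets_holds : BISAPReducibleDownsets := by
  obtain ⟨f, hf, hfcore⟩ := TwoColouring.coreFP
  -- the decision stage and its value on every string
  have hD1 : ∀ w, (fstF ∘ f ∘ bisPre) w =
      [(TwoColouring.core (decodeNat (fstF (fstF (fstF w)))) (sndF (fstF (fstF w)))).1] := fun w => by
    rw [Function.comp_apply, Function.comp_apply, bisPre_apply, hfcore, pairE_apply, fstF_boolPair]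
    rfl
  have hD : (fstF ∘ f ∘ bisPre) ∈ FP := comp_mem_FP fstF_mem_FP (comp_mem_FP hf bisPre_mem_FP)
  have hQ := bisQuery_mem_FP hf
  obtain ⟨P, hP⟩ := exists_poly_length_le_of_mem_FP hQ
  refine APReducible.intro_of_forall (OracleAlg.oneQuery (fstF ∘ f ∘ bisPre) (bisQuery f) (fun _ => []) sndF)
    (OracleAlg.isPolyTime_oneQuery _ _ _ _ hD (fun w => ⟨_, hD1 w⟩) hQ (const_mem_FP _) sndF_mem_FP)
    (P + 2) (fun w E z hz => ?_) (fun x kη kδ u R hkη _ hR => ?_)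
  · -- the only query is `bisQuery f w`
    rcases E with _ | ⟨a, _ | ⟨a', E⟩⟩
    · simp only [OracleAlg.oneQuery] at hz
      split_ifs at hz
      rw [Sum.inl.injEq] at hz
      rw [← hz, eval_add]
      exact (hP w).trans (Nat.le_add_right _ _)
    · simp [OracleAlg.oneQuery] at hz
    · simp [OracleAlg.oneQuery] at hz
  · -- the run: two rounds
    set w := countQuery x 0 kη kδ u with hw
    set n := decodeNat (fstF x) with hn
    set v := sndF x with hv
    have hDw : (fstF ∘ f ∘ bisPre) w = [(TwoColouring.core n v).1] := by
      rw [hD1 w, hw, countQuery, fstF_boolPair, fstF_boolPair]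
    have hyw : sndF (f (bisPre w)) = pairE natE (listE natE) (TwoColouring.core n v).2 := by
      rw [hw, bisPre_countQuery, hfcore, pairE_apply, sndF_boolPair]
    have heval : (P + 2).eval w.length = P.eval w.length + 1 + 1 := by simp [eval_add]
    rw [heval, OracleAlg.runRule_succ]
    cases hgood : (TwoColouring.core n v).1
    · -- silent: answer `0`
      have hstep : (OracleAlg.oneQuery (fstF ∘ f ∘ bisPre) (bisQuery f) (fun _ => []) sndF).step w [] =
          Sum.inr [] := by
        simp only [OracleAlg.oneQuery, hDw, hgood]
        simp
      simp only [hstep]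
      refine ⟨[], rfl, ?_⟩
      rw [TwoColouring.bisCount_eq_zero_of_not_good (x := x) hgood]
      exact isApproxCount_self kη 0
    · -- one query, answer returned verbatim
      have hstep : (OracleAlg.oneQuery (fstF ∘ f ∘ bisPre) (bisQuery f) (fun _ => []) sndF).step w [] =
          Sum.inl (bisQuery f w) := by
        simp only [OracleAlg.oneQuery, hDw, hgood]
        simp
      simp only [hstep, List.nil_append]
      rw [OracleAlg.runRule_succ]
      simp only [OracleAlg.oneQuery, sndF_boolPair]
      refine ⟨_, rfl, ?_⟩
      rw [TwoColouring.bisCount_eq_downsetCount_of_good (x := x) hgood, ← hyw, hw, bisQuery_countQuery, ← hw]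
      exact hR [] _ kη hkη

end DyerEtAl2003

end Literature.Computability.Complexity
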